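import Summits.CriticalPhenomena.PercolationContinuityZ3.Theorems.PercNearOneGluingNoHeavyLowerTailSahiE3LroOrStep
import Mathlib.Tactic.Linarith
import Mathlib.Tactic.Ring
import Mathlib.Tactic.Positivity
import HarnessLib
import HarnessLib.Audit

/-!
# `NoHeavyLowerTail` (crux stmt-CriticalPhenomena-4575), Sahi programme P4 (Holley / monotone coupling):
# linear read-once slots, file 3 — the AND-step of the attribution certificate, and the base cases

Support file (cell `prim-l12`, seat P4, generation 11; `--supports stmt-CriticalPhenomena-4575`).  No named facts, no sorries;
standard axioms; def-free.

THEOREM `cert_and_step`: a flow certificate with exact deliveries for `(Q, ν', G)` (Harris weight `ν'`) lifts to the slot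
`{(true, t) | t ∈ G}` ("`x ∧ G`") of `Bool × Q` with the layered product weight — filter-locality (`…SahiE3FilterRestriction`)
in certificate form: `R(true, t) = (p+q)²p·R'(t)`, receivers `(false, s)`, `s ∈ G`, served by `(true, s)`, the rest by the
lifted `G`-certificate; the pair inequality is `(p+q)²p·[pair'] + (p+q)pq·(m₁·[Harris] + m₂·[Harris]) + pq²N'_G·m₁m₂ ≥ 0`.
Base cases: `cert_empty` (empty slot, zero certificate) and `harris_unit` (the one-point pattern).  See `…SahiE3LroOrStep`.
-/

namespace Summit.CriticalPhenomena.PercolationContinuityZ3.Theorems.SahiE3LroAndStep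

open Finset SahiE3LroLayers SahiE3LroOrStep
open scoped BigOperators

variable {Q : Type*} [Fintype Q] [DecidableEq Q] [PartialOrder Q]

/-! ## The AND-step -/

omit [PartialOrder Q] in
/-- Layers of the slot `U = {(true, t) | t ∈ G}` and of its complement, and of intersections with it. [this work] -/
theorem layers_andSlot (G : Finset Q) (U : Finset (Bool × Q)) (hU : ∀ x, x ∈ U ↔ (x.1 = true ∧ x.2 ∈ G))
    (X : Finset (Bool × Q)) :
    univ.filter (fun t => (true, t) ∈ X ∩ U) = univ.filter (fun t => (true, t) ∈ X) ∩ G ∧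
    univ.filter (fun t => (false, t) ∈ X ∩ U) = ∅ ∧
    univ.filter (fun t => (true, t) ∈ Uᶜ) = Gᶜ ∧
    univ.filter (fun t => (false, t) ∈ Uᶜ) = univ ∧
    univ.filter (fun t => (true, t) ∈ U) = G ∧
    univ.filter (fun t => (false, t) ∈ U) = ∅ := by
  refine ⟨?_, ?_, ?_, ?_, ?_, ?_⟩ <;> ext t <;> simp [hU]

/-- **AND-step of the linear read-once certificate** (filter-locality in certificate form).  With the data of `cert_or_step`,
the slot `U = {(true, t) | t ∈ G}` ("`x ∧ G`") of `Bool × Q` with the layered product weight carries a flow certificate with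
exact deliveries: `R(true, t) = (p+q)²p·R'(t)`, the receivers `(false, s)`, `s ∈ G` served by `(true, s)`, all others by the
`G`-certificate lifted to the top layer.  The pair inequality is the identity
`RHS − LHS = (p+q)²p·[pair'] + (p+q)pq·((s₁−s₀)·[Harris(S₁',G)] + (s₁'−s₀')·[Harris(S₁,G)]) + pq²N'_G·(s₁−s₀)(s₁'−s₀')`. [this work] -/
theorem cert_and_step {ν' : Q → ℝ} (hν' : ∀ t, 0 ≤ ν' t)
    (hH : ∀ S S' : Finset Q, IsUpperSet (S : Set Q) → IsUpperSet (S' : Set Q) →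
      (∑ t ∈ S, ν' t) * (∑ t ∈ S', ν' t) ≤ (∑ t, ν' t) * ∑ t ∈ S ∩ S', ν' t)
    (G : Finset Q) (hG : IsUpperSet (G : Set Q)) (R' : Q → ℝ) (Fl' : Q → Q → ℝ)
    (hR'0 : ∀ t ∈ G, 0 ≤ R' t) (hF'0 : ∀ t s, 0 ≤ Fl' t s) (hF'le : ∀ t s, Fl' t s ≠ 0 → s ≤ t)
    (hcap' : ∀ t ∈ G, R' t + ∑ s ∈ Gᶜ, Fl' t s ≤ (∑ r, ν' r) * ((∑ r, ν' r) + ∑ r ∈ Gᶜ, ν' r) * ν' t)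
    (hK' : ∀ s ∈ Gᶜ, ∑ t ∈ G, Fl' t s = (∑ r, ν' r) * (∑ r ∈ G, ν' r) * ν' s)
    (hpair' : ∀ S S' : Finset Q, IsUpperSet (S : Set Q) → IsUpperSet (S' : Set Q) →
      (∑ r, ν' r) * ((∑ t ∈ S, ν' t) * (∑ t ∈ S' ∩ G, ν' t) + (∑ t ∈ S', ν' t) * (∑ t ∈ S ∩ G, ν' t))
          - (∑ r ∈ G, ν' r) * (∑ t ∈ S, ν' t) * (∑ t ∈ S', ν' t) ≤ ∑ t ∈ (S ∩ S') ∩ G, R' t)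
    {p q : ℝ} (hp : 0 ≤ p) (hq : 0 ≤ q) (ν : Bool × Q → ℝ) (hνt : ∀ t, ν (true, t) = p * ν' t)
    (hνf : ∀ t, ν (false, t) = q * ν' t) (U : Finset (Bool × Q)) (hU : ∀ x, x ∈ U ↔ (x.1 = true ∧ x.2 ∈ G)) :
    ∃ (R : Bool × Q → ℝ) (Fl : (Bool × Q) → (Bool × Q) → ℝ),
      (∀ t ∈ U, 0 ≤ R t) ∧ (∀ t s, 0 ≤ Fl t s) ∧ (∀ t s, Fl t s ≠ 0 → s ≤ t) ∧
      (∀ t ∈ U, R t + ∑ s ∈ Uᶜ, Fl t s ≤ (∑ r, ν r) * ((∑ r, ν r) + ∑ r ∈ Uᶜ, ν r) * ν t) ∧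
      (∀ s ∈ Uᶜ, ∑ t ∈ U, Fl t s = (∑ r, ν r) * (∑ r ∈ U, ν r) * ν s) ∧
      (∀ S S' : Finset (Bool × Q), IsUpperSet (S : Set (Bool × Q)) → IsUpperSet (S' : Set (Bool × Q)) →
        (∑ r, ν r) * ((∑ t ∈ S, ν t) * (∑ t ∈ S' ∩ U, ν t) + (∑ t ∈ S', ν t) * (∑ t ∈ S ∩ U, ν t))
            - (∑ r ∈ U, ν r) * (∑ t ∈ S, ν t) * (∑ t ∈ S', ν t) ≤ ∑ t ∈ (S ∩ S') ∩ U, R t) := by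
  have LcT := (layers_andSlot G U hU U).2.2.1
  have LcF := (layers_andSlot G U hU U).2.2.2.1
  have LuT := (layers_andSlot G U hU U).2.2.2.2.1
  have LuF := (layers_andSlot G U hU U).2.2.2.2.2
  obtain ⟨Z', hZ'⟩ : ∃ x : ℝ, ∑ t, ν' t = x := ⟨_, rfl⟩
  obtain ⟨NG, hNG⟩ : ∃ x : ℝ, ∑ t ∈ G, ν' t = x := ⟨_, rfl⟩
  obtain ⟨ND, hND⟩ : ∃ x : ℝ, ∑ t ∈ Gᶜ, ν' t = x := ⟨_, rfl⟩
  have hsplit : Z' = NG + ND := by rw [← hZ', ← hNG, ← hND]; exact (Finset.sum_add_sum_compl G ν').symm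
  have hZ'0 : 0 ≤ Z' := hZ' ▸ Finset.sum_nonneg fun t _ => hν' t
  have hNG0 : 0 ≤ NG := hNG ▸ Finset.sum_nonneg fun t _ => hν' t
  have hND0 : 0 ≤ ND := hND ▸ Finset.sum_nonneg fun t _ => hν' t
  rw [hZ'] at hH; rw [hZ', hND] at hcap'; rw [hZ', hNG] at hK' hpair'
  have lay : ∀ X : Finset (Bool × Q), ∑ x ∈ X, ν x =
      p * ∑ t ∈ univ.filter (fun t => (true, t) ∈ X), ν' t + q * ∑ t ∈ univ.filter (fun t => (false, t) ∈ X), ν' t := by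
    intro X
    rw [sum_layers, Finset.mul_sum, Finset.mul_sum]
    exact congrArg₂ (· + ·) (Finset.sum_congr rfl fun t _ => hνt t) (Finset.sum_congr rfl fun t _ => hνf t)
  have eZ : ∑ x, ν x = (p + q) * Z' := by
    rw [sum_layers_univ, show ∑ t, ν (true, t) = p * ∑ t, ν' t by
        rw [Finset.mul_sum]; exact Finset.sum_congr rfl fun t _ => hνt t,
      show ∑ t, ν (false, t) = q * ∑ t, ν' t by
        rw [Finset.mul_sum]; exact Finset.sum_congr rfl fun t _ => hνf t, hZ']
    ring
  have eU : ∑ x ∈ U, ν x = p * NG := by rw [lay U, LuT, LuF, Finset.sum_empty, mul_zero, add_zero, hNG]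
  have eUc : ∑ x ∈ Uᶜ, ν x = p * ND + q * Z' := by rw [lay Uᶜ, LcT, LcF, hND, hZ']
  -- the certificate
  refine ⟨fun x => if x.1 = true then (p + q) ^ 2 * p * R' x.2 else 0,
    fun x y => if x.1 = true then (if y.1 = true then (p + q) * p ^ 2 * Fl' x.2 y.2 else
      (if y.2 ∈ G then (if x.2 = y.2 then (p + q) * Z' * (p * NG) * (q * ν' y.2) else 0)
        else (p + q) * p * q * Fl' x.2 y.2)) else 0, ?_, ?_, ?_, ?_, ?_, ?_⟩
  · -- (R0)
    rintro ⟨b, t⟩ hx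
    have hbt : b = true ∧ t ∈ G := by simpa using (hU (b, t)).1 hx
    obtain ⟨rfl, ht⟩ := hbt
    have := hR'0 t ht
    simp only [↓reduceIte]
    positivity
  · -- (F0)
    rintro ⟨b, t⟩ ⟨b', s⟩
    have := hF'0 t s; have := hν' s
    dsimp only
    split_ifs <;> positivity
  · -- (F≤)
    rintro ⟨b, t⟩ ⟨b', s⟩ h
    dsimp only at h
    cases b <;> cases b' <;> simp only [Bool.false_eq_true, ↓reduceIte, ne_eq, not_true_eq_false] at h ⊢
    · -- t = (true, t), s = (false, s)
      refine ⟨Bool.false_le _, ?_⟩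
      by_cases hsG : s ∈ G
      · simp only [hsG, ↓reduceIte] at h
        by_cases hts : t = s
        · exact hts ▸ le_rfl
        · exact absurd (by simp [hts]) h
      · simp only [hsG, ↓reduceIte] at h
        exact hF'le t s (by intro h0; exact h (by rw [h0, mul_zero]))
    · exact ⟨le_rfl, hF'le t s (by intro h0; exact h (by rw [h0, mul_zero]))⟩
  · -- (cap)
    rintro ⟨b, t⟩ hx
    have hbt : b = true ∧ t ∈ G := by simpa using (hU (b, t)).1 hx
    obtain ⟨rfl, ht⟩ := hbt
    have hνt0 := hν' t
    rw [sum_layers, LcT, LcF, eZ, eUc, hνt]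
    simp only [↓reduceIte, Bool.false_eq_true]
    rw [Finset.sum_ite, Finset.sum_ite_eq]
    have f1 : univ.filter (fun s : Q => s ∈ G) = G := by ext s; simp
    have f2 : univ.filter (fun s : Q => ¬ s ∈ G) = Gᶜ := by ext s; simp
    rw [f1, f2]
    simp only [ht, ↓reduceIte]
    rw [← Finset.mul_sum, ← Finset.mul_sum]
    have hc := hcap' t ht
    have hR := hR'0 t ht
    have hFs : 0 ≤ ∑ s ∈ Gᶜ, Fl' t s := Finset.sum_nonneg fun s _ => hF'0 t s
    have key : (p + q) ^ 2 * p * R' t + ((p + q) * p ^ 2 * ∑ s ∈ Gᶜ, Fl' t s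
        + ((p + q) * Z' * (p * NG) * (q * ν' t) + (p + q) * p * q * ∑ s ∈ Gᶜ, Fl' t s)) =
        (p + q) ^ 2 * p * (R' t + ∑ s ∈ Gᶜ, Fl' t s) + (p + q) * Z' * (p * NG) * (q * ν' t) := by ring
    rw [key]
    have e2 : (p + q) ^ 2 * p * (Z' * (Z' + ND) * ν' t) + (p + q) * Z' * (p * NG) * (q * ν' t) =
        (p + q) * Z' * ((p + q) * Z' + (p * ND + q * Z')) * (p * ν' t) := by rw [hsplit]; ring
    linarith [mul_le_mul_of_nonneg_left hc (by positivity : 0 ≤ (p + q) ^ 2 * p), e2]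
  · -- (K) with equality
    rintro ⟨b, s⟩ hs
    rw [sum_layers, LuT, LuF, Finset.sum_empty, add_zero, eZ, eU]
    cases b
    · simp only [Bool.false_eq_true, ↓reduceIte, hνf]
      by_cases hsG : s ∈ G
      · simp only [hsG, ↓reduceIte]
        rw [Finset.sum_ite_eq' G s, if_pos hsG]
      · simp only [hsG, ↓reduceIte]
        rw [← Finset.mul_sum, hK' s (by simpa using hsG)]; ring
    · have hsG : s ∉ G := by simpa [hU] using hs
      simp only [↓reduceIte, hνt]
      rw [← Finset.mul_sum, hK' s (by simpa using hsG)]; ring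
  · -- (pair)
    intro S S' hS hS'
    set S1 := univ.filter (fun t => (true, t) ∈ S) with hS1
    set S0 := univ.filter (fun t => (false, t) ∈ S) with hS0
    set T1 := univ.filter (fun t => (true, t) ∈ S') with hT1
    set T0 := univ.filter (fun t => (false, t) ∈ S') with hT0
    have u1 : IsUpperSet (S1 : Set Q) := isUpperSet_layer hS true
    have v1 : IsUpperSet (T1 : Set Q) := isUpperSet_layer hS' true
    have hGu : IsUpperSet (G : Set Q) := hG
    have eS : ∑ x ∈ S, ν x = p * ∑ t ∈ S1, ν' t + q * ∑ t ∈ S0, ν' t := lay S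
    have eS' : ∑ x ∈ S', ν x = p * ∑ t ∈ T1, ν' t + q * ∑ t ∈ T0, ν' t := lay S'
    have eSU : ∑ x ∈ S ∩ U, ν x = p * ∑ t ∈ S1 ∩ G, ν' t := by
      rw [lay, (layers_andSlot G U hU S).1, (layers_andSlot G U hU S).2.1, Finset.sum_empty, mul_zero, add_zero]
    have eS'U : ∑ x ∈ S' ∩ U, ν x = p * ∑ t ∈ T1 ∩ G, ν' t := by
      rw [lay, (layers_andSlot G U hU S').1, (layers_andSlot G U hU S').2.1, Finset.sum_empty, mul_zero, add_zero]
    have eR : ∑ x ∈ (S ∩ S') ∩ U, (fun x : Bool × Q => if x.1 = true then (p + q) ^ 2 * p * R' x.2 else 0) x =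
        (p + q) ^ 2 * p * ∑ t ∈ S1 ∩ T1 ∩ G, R' t := by
      rw [sum_layers, (layers_andSlot G U hU (S ∩ S')).1, (layers_andSlot G U hU (S ∩ S')).2.1, layers_inter,
        Finset.sum_empty, add_zero]
      simp only [↓reduceIte]
      rw [← hS1, ← hT1, ← Finset.mul_sum]
    have H5 := hpair' S1 T1 u1 v1
    have K1 := hH T1 G v1 hGu
    have K2 := hH S1 G u1 hGu
    have m1 : ∑ t ∈ S0, ν' t ≤ ∑ t ∈ S1, ν' t := sum_le_sum_of_subset' hν' (layer_false_subset_true hS)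
    have m2 : ∑ t ∈ T0, ν' t ≤ ∑ t ∈ T1, ν' t := sum_le_sum_of_subset' hν' (layer_false_subset_true hS')
    have n1 : 0 ≤ ∑ t ∈ S0, ν' t := Finset.sum_nonneg fun t _ => hν' t
    have n2 : 0 ≤ ∑ t ∈ T0, ν' t := Finset.sum_nonneg fun t _ => hν' t
    rw [eZ, eU, eS, eS', eSU, eS'U, eR]
    have P5 : 0 ≤ (p + q) ^ 2 * p * (∑ t ∈ S1 ∩ T1 ∩ G, R' t - (Z' * ((∑ t ∈ S1, ν' t) * ∑ t ∈ T1 ∩ G, ν' t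
        + (∑ t ∈ T1, ν' t) * ∑ t ∈ S1 ∩ G, ν' t) - NG * (∑ t ∈ S1, ν' t) * ∑ t ∈ T1, ν' t)) :=
      mul_nonneg (by positivity) (sub_nonneg.2 H5)
    have P1 : 0 ≤ (p + q) * p * q * ((∑ t ∈ S1, ν' t - ∑ t ∈ S0, ν' t)
        * (Z' * ∑ t ∈ T1 ∩ G, ν' t - (∑ t ∈ T1, ν' t) * NG)) :=
      mul_nonneg (by positivity) (mul_nonneg (sub_nonneg.2 m1) (by nlinarith [K1]))
    have P2 : 0 ≤ (p + q) * p * q * ((∑ t ∈ T1, ν' t - ∑ t ∈ T0, ν' t)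
        * (Z' * ∑ t ∈ S1 ∩ G, ν' t - (∑ t ∈ S1, ν' t) * NG)) :=
      mul_nonneg (by positivity) (mul_nonneg (sub_nonneg.2 m2) (by nlinarith [K2]))
    have P6 : 0 ≤ p * q ^ 2 * NG * ((∑ t ∈ S1, ν' t - ∑ t ∈ S0, ν' t) * (∑ t ∈ T1, ν' t - ∑ t ∈ T0, ν' t)) :=
      mul_nonneg (by positivity) (mul_nonneg (sub_nonneg.2 m1) (sub_nonneg.2 m2))
    linarith [P5, P1, P2, P6]

/-! ## Base certificates -/

/-- The empty slot carries the zero certificate (exact deliveries: nothing to deliver). [this work] -/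
theorem cert_empty (ν : Q → ℝ) :
    ∃ (R : Q → ℝ) (Fl : Q → Q → ℝ),
      (∀ t ∈ (∅ : Finset Q), 0 ≤ R t) ∧ (∀ t s, 0 ≤ Fl t s) ∧ (∀ t s, Fl t s ≠ 0 → s ≤ t) ∧
      (∀ t ∈ (∅ : Finset Q), R t + ∑ s ∈ (∅ : Finset Q)ᶜ, Fl t s ≤ (∑ r, ν r) * ((∑ r, ν r) + ∑ r ∈ (∅ : Finset Q)ᶜ, ν r) * ν t) ∧
      (∀ s ∈ (∅ : Finset Q)ᶜ, ∑ t ∈ (∅ : Finset Q), Fl t s = (∑ r, ν r) * (∑ r ∈ (∅ : Finset Q), ν r) * ν s) ∧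
      (∀ S S' : Finset Q, IsUpperSet (S : Set Q) → IsUpperSet (S' : Set Q) →
        (∑ r, ν r) * ((∑ t ∈ S, ν t) * (∑ t ∈ S' ∩ ∅, ν t) + (∑ t ∈ S', ν t) * (∑ t ∈ S ∩ ∅, ν t))
            - (∑ r ∈ (∅ : Finset Q), ν r) * (∑ t ∈ S, ν t) * (∑ t ∈ S', ν t) ≤ ∑ t ∈ (S ∩ S') ∩ ∅, R t) :=
  ⟨fun _ => 0, fun _ _ => 0, by simp, by simp, by simp, by simp, by simp, by simp⟩

/-- The trivial pattern `Unit` with any weight satisfies Harris' inequality for up-sets. [folklore] -/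
theorem harris_unit (ν : Unit → ℝ) (S S' : Finset Unit) :
    (∑ t ∈ S, ν t) * (∑ t ∈ S', ν t) ≤ (∑ t, ν t) * ∑ t ∈ S ∩ S', ν t := by
  have hu : ∀ X : Finset Unit, X = ∅ ∨ X = univ := fun X => by
    by_cases h : () ∈ X
    · right; ext u; simp [h]
    · left; ext u; simp [h]
  rcases hu S with rfl | rfl <;> rcases hu S' with rfl | rfl <;> simp


end Summit.CriticalPhenomena.PercolationContinuityZ3.Theorems.SahiE3LroAndStep
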